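import Mathlib
import Summits.ValiantsHypothesis.ValiantsHypothesis.Theses.NewtonUnitEquations
import Summits.ValiantsHypothesis.ValiantsHypothesis.Theorems.NewtonUnitEquationsTwoProductsFormalLogLinearisationSectorDecomposition
import Summits.ValiantsHypothesis.ValiantsHypothesis.Theorems.NewtonUnitEquationsTwoProductsFormalLogLinearisationStubChartNormalisation
import Summits.ValiantsHypothesis.ValiantsHypothesis.Theorems.NewtonUnitEquationsTwoProductsFormalLogLinearisationStubLogLinearisation
import Summits.ValiantsHypothesis.ValiantsHypothesis.Theorems.NewtonUnitEquationsTwoProductsFormalLogLinearisationStubRaysRung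
import Literature.Computability.AlgebraicComplexity.NewtonPolygonTau
import Literature.Computability.AlgebraicComplexity.NewtonPolygonTauBounds
-- import Summits.ValiantsHypothesis.ValiantsHypothesis.Theorems.TwoProducts.Negative.RankObstruction
--   (landed p74535; NOT imported: the farm snapshot reports the module `unbuilt` (lean check rc 75) at publication —
--    its core lemma is restated and re-proved below as `card_corners_le_of_expSum'` for the scratch check)

/-!
# Skeleton line `formal-log-linearisation` for crux `TwoProducts` (stmt-ValiantsHypothesis-5906)

Route `NewtonUnitEquations` (shared with `NewtonFrames`), crux r3 `TwoProducts` =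
`∃ a b, ∀ m t (f g : Fin m → ℂ[X,Y])`, every `f j`, `g j` with `≤ t` monomials ⇒
`#vert Newt(∏ f − ∏ g) ≤ 2^(a·m)·(t+2)^b`.

## The line (idea card `formal-log-linearisation`, merged with `corner-log-linearization` / `tangent-cone-logarithm`
by all three triagers: ONE lever)

LEVER. Away from the `≤ 2mt` critical directions (normals of edges of the factors' Newton polygons) every factor has
a unique top monomial; on a SECTOR (arc between critical directions) where the two top monomials `αX^A`, `βX^B` of
the products do NOT cancel, `Newt(∏f − ∏g)` shows `≤ 2` vertices; on a CANCELLING sector (`A = B`, `α = β`) one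
changes chart by `GL₂(ℤ)` + translation so that the corner is the constant term `1` and all tails lie in `ℕ² ∖ 0`,
and takes logarithms in `ℂ[[X,Y]]`:

  `∏_j (1+u_j) − ∏_j (1+v_j) = D · U`,  `D = Σ_j log(1+u_j) − Σ_j log(1+v_j)`,  `U = ∏(1+v_j)·(e^D − 1)/D` a unit with
  `in_ξ U = 1` for every valid weight `ξ` (negative on all tails), hence **`in_ξ(∏(1+u) − ∏(1+v)) = in_ξ(D)`**:
  the hidden vertices of the sector are exactly the weight-visible points of the support of the SIGNED SUM OF `2m`
  LOGARITHMS OF SPARSE POLYNOMIALS — products are gone, each factor enters alone ("additive decoupling"), the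
  coefficients are explicit signed multinomial power sums `[D]_λ = Σ_{π(n)=λ} (−1)^{|n|+1}(|n|−1)!/n! · Σ_j ε_j c_jⁿ`,
  and `supp D ⊆ ⋃_j ℕ·supp(u_j) ∪ ⋃_j ℕ·supp(v_j)` (single-factor semigroups).

SKELETON = 5 registered stubs + proved glue:

* `stub_sectorDecomposition` (M, provable now; planar convex geometry + `in_ξ(∏ f_j) = ∏ in_ξ(f_j)`):
  `V(∏f − ∏g) ≤ 4mt + 2 + 2mt·B` whenever every cancelling top-assignment `(a,b)` has `≤ B` hidden vertices.
* `stub_chartNormalisation` (M, provable now; `GL₂(ℤ)` chart on exponents + translation by the corner): the hidden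
  set of a cancelling top-assignment injects into the visible set of a NORMALISED instance `(u,v)`
  (`u_j(0) = v_j(0) = 0`, `≤ t − 1` monomials each: the tails).
* `stub_logLinearisation` (M/L, provable now; formal `exp`/`log` in `MvPowerSeries (Fin 2) ℂ`, char 0): for a valid
  weight, strict top of `supp(∏(1+u) − ∏(1+v))` ⟺ strict top of `supp D` (the identity above; `log` is written out
  coefficientwise, `logCoeff`, exact by total-degree truncation).
* `stub_raysRung` (M, provable now; Disproof F3 / card (ii), triage-checked): MONOMIAL tails (binomial factors, `t ≤ 2`):
  each `log(1+u_j)` lives on one ray and only the first support point of a ray can be visible, so `≤ 2m` visible points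
  — for arbitrary binomials this is `V ≤ 8m² + O(m)` in ALL regimes, strictly beyond route item `BinomialPencil` (5908).
* `stub_logSumEngine` (XL, OPEN — THE HARDEST STUB; = the card's Transfer `C⁺` for tails with `≥ 2` allowed monomials,
  judged "honest reformulation, real why-easier" by TRIAGE r1-1/2/3): any finite set of weight-visible points of `supp D`
  has `≤ 2^(a·m)(t+2)^b` elements. Known sub-regime beyond rays (typed below as `EngineCommonConeRung`, a target for a
  `--supports` lemma): common two-monomial tail cone (Disproof F4 / landed `Negative.card_corners_le_of_expSum`: `≤ 2m`);
  conjectured truth: Disproof's `FirstOrderCount` (`≤ 2m(t−1)` per sector).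

`TwoProducts_of` composes the five stubs into the crux BY NAME (kernel-checked, no `sorry`): for each cancelling
top-assignment the chart (stub 2) gives tails with `≤ t−1` monomials; if `t ≤ 2` the rays rung (stub 4), else the engine
(stub 5, at `t−1 ≥ 2`), bounds the visible points of `supp D`, and the identity (stub 3) transports this to the visible
set (`visible_ncard_le_of`; `visible ⊆ support` is finite — proved); so every hidden set is `≤ B = 2^((a+1)m)(t+2)^(b+1)`
(`two_mul_le_bound`, `engine_le_bound`), the sector decomposition (stub 1) gives `V ≤ 4mt + 2 + 2mt·B`, and `bound_arith`
(proved) closes with the constants `(a+1+4, b+1+2)`.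

## Disproof used (`Cruxes/TwoProducts/Disproof.lean`, cdisprove cycle 1, read 2026-08-16)
* `twoProducts_false_without_sparsityF` / `…G` — HONOURED: sparsity of BOTH products is used twice, in
  `stub_sectorDecomposition` (`#critical directions ≤ Σ_j |supp f_j| + |supp g_j| ≤ 2mt`) and in `stub_raysRung` /
  `stub_logSumEngine` (both tail families `u`, `v` are sparse; with `v` unrestricted `D` is an arbitrary series).
* `not_twoProductsBoundFreeOfT`, `not_twoProductsBoundFreeOfM` (KPTT parabola / q-Pochhammer `∏(1+XY^j)`) — HONOURED:
  the engine bound keeps the full shape `2^(a·m)(t+2)^b`; the q-Pochhammer family is `t = 2` (monomial tails: rays),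
  i.e. the slice of `stub_raysRung` (`≤ 2m` per sector; the rank-method bound `2m` is sharp: `corners_rank_tight`).
* §4 / landed `Theorems/TwoProducts/Negative/RankObstruction.lean` — USED POSITIVELY (imported; scratch `example`
  below, re-proved since the module is unbuilt on the farm): it is the common-cone rung of `stub_logSumEngine`. No
  landed Negative lemma refutes an instance of any stub
  (the Negative file contains no `¬`-statement about the crux's objects). `-- Targets`: none in Disproof.lean.
* §3 F9 `FirstOrderCount` — recorded as the conjectured sharp form of the engine; NOT assumed (the stub keeps the
  crux's shape, so it is no stronger than the crux: `stub_logSumEngine ⇔ TwoProducts` given stubs 1–3; ⟸ because a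
  visible point of `supp D` is a strict top of `supp(∏(1+u) − ∏(1+v))` by stub 3, hence an exposed hull vertex).
* TRIAGE kills honoured: the refuted literal pairing/identifiability expectation (v) of the card (toy A:
  re-factorisation `(1+x)(1+y)+x^Ny^N`; instance B: cubic norm, interior dead ray) is NOT a stub — the engine is
  stated as a COUNT, not as a pairing mechanism; `EulerWronskianTransfer` (side rung per triage) is not load-bearing.
-/

set_option linter.dupNamespace false
set_option linter.unusedVariables false

noncomputable section

open scoped BigOperators
open MvPolynomial Literature.Computability.AlgebraicComplexity

namespace Summit.ValiantsHypothesis.ValiantsHypothesis.Cruxes.TwoProducts.FormalLogLinearisation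

/-! ### Objects of the line (small transparent definitions over Mathlib) -/

/-- Exponent vectors of bivariate monomials. -/
abbrev Expo := Fin 2 →₀ ℕ

/-- The weight `⟪ξ, e⟫ = ξ₀·e₀ + ξ₁·e₁` of an exponent vector for a real weight vector `ξ`. -/
def wt (ξ : Fin 2 → ℝ) (e : Expo) : ℝ := ξ 0 * ((e 0 : ℕ) : ℝ) + ξ 1 * ((e 1 : ℕ) : ℝ)

/-- `l` is the STRICT `ξ`-top of the set `S`: `l ∈ S` and every other point of `S` has smaller weight.
(For `S` = a support and `ξ` generic this says: `l` is the vertex of `conv S` exposed by `ξ`.) -/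
def IsStrictTop (ξ : Fin 2 → ℝ) (S : Set Expo) (l : Expo) : Prop :=
  l ∈ S ∧ ∀ μ ∈ S, μ ≠ l → wt ξ μ < wt ξ l

variable {m : ℕ}

/-- A top-assignment `(a, b)` (one exponent per factor) is CANCELLING when the two top monomials of the products
coincide with equal coefficients: `Σ a_j = Σ b_j` and `∏ [X^{a_j}] f_j = ∏ [X^{b_j}] g_j`. -/
def Cancelling (f g : Fin m → MvPolynomial (Fin 2) ℂ) (a b : Fin m → Expo) : Prop :=
  ∑ j, a j = ∑ j, b j ∧ ∏ j, coeff (a j) (f j) = ∏ j, coeff (b j) (g j)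

/-- HIDDEN VERTICES of the sector of the top-assignment `(a, b)`: support points of `∏ f − ∏ g` that are the strict
`ξ`-top for some weight `ξ` making `a j` the strict top of `supp f_j` and `b j` the strict top of `supp g_j` for
every `j` (such `ξ` form one open arc of directions — the sector; empty set if no `ξ` realises `(a,b)`). -/
def hidden (f g : Fin m → MvPolynomial (Fin 2) ℂ) (a b : Fin m → Expo) : Set Expo :=
  {l | ∃ ξ : Fin 2 → ℝ, (∀ j, IsStrictTop ξ ↑(f j).support (a j)) ∧ (∀ j, IsStrictTop ξ ↑(g j).support (b j)) ∧
    IsStrictTop ξ ↑(∏ j, f j - ∏ j, g j).support l}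

/-- VALID WEIGHTS of a normalised instance `(u, v)` (tails): `ξ` is negative on every tail exponent, i.e. the
constant term is the strict `ξ`-top of every factor `1 + u_j`, `1 + v_j`. -/
def ValidWeight (u v : Fin m → MvPolynomial (Fin 2) ℂ) (ξ : Fin 2 → ℝ) : Prop :=
  (∀ j, ∀ e ∈ (u j).support, wt ξ e < 0) ∧ (∀ j, ∀ e ∈ (v j).support, wt ξ e < 0)

/-- The normalised difference of products `∏ (1 + u_j) − ∏ (1 + v_j)`. -/
def tailDiff (u v : Fin m → MvPolynomial (Fin 2) ℂ) : MvPolynomial (Fin 2) ℂ :=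
  ∏ j, (1 + u j) - ∏ j, (1 + v j)

/-- VISIBLE VERTICES of a normalised instance: strict `ξ`-tops of `supp(∏(1+u) − ∏(1+v))` over all valid `ξ`. -/
def visible (u v : Fin m → MvPolynomial (Fin 2) ℂ) : Set Expo :=
  {l | ∃ ξ : Fin 2 → ℝ, ValidWeight u v ξ ∧ IsStrictTop ξ ↑(tailDiff u v).support l}

/-- The coefficient of `X^n` in the formal logarithm `log(1 + u) = Σ_{r ≥ 1} (−1)^{r+1} u^r / r` for a polynomial `u`
with `u(0) = 0`: since every monomial of `u` has total degree `≥ 1`, only `r ≤ n₀ + n₁` contribute, so the series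
coefficient is this FINITE sum (exact truncation by total degree; no `MvPowerSeries.log` needed). -/
def logCoeff (u : MvPolynomial (Fin 2) ℂ) (n : Expo) : ℂ :=
  ∑ r ∈ Finset.Icc 1 (n 0 + n 1), (-1 : ℂ) ^ (r + 1) / (r : ℂ) * coeff n (u ^ r)

/-- The log-sum `D = Σ_j log(1 + u_j) − Σ_j log(1 + v_j)`, coefficientwise. -/
def logDiff (u v : Fin m → MvPolynomial (Fin 2) ℂ) (n : Expo) : ℂ :=
  ∑ j, logCoeff (u j) n - ∑ j, logCoeff (v j) n

/-- The support of the log-sum `D` (an infinite subset of `ℕ²` in general). -/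
def logSupport (u v : Fin m → MvPolynomial (Fin 2) ℂ) : Set Expo :=
  {n | logDiff u v n ≠ 0}

/-- VISIBLE POINTS OF THE LOG-SUM: strict `ξ`-tops of `supp D` over all valid weights `ξ` (the vertices of the
Newton polyhedron `conv(supp D) + (recession cone)` seen from the sector). -/
def logVisible (u v : Fin m → MvPolynomial (Fin 2) ℂ) : Set Expo :=
  {l | ∃ ξ : Fin 2 → ℝ, ValidWeight u v ξ ∧ IsStrictTop ξ (logSupport u v) l}

/-! ### The statements of the line (named `Prop`s) -/

/-- STATEMENT 1 — sector decomposition. If every cancelling top-assignment has at most `B` hidden vertices, then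
`#vert Newt(∏f − ∏g) ≤ 4mt + 2 + 2mt·B`. (Critical directions `≤ 2mt`; on each of the `≤ 2mt` arcs between them
the tops are constant: non-cancelling arcs expose `≤ 2` vertices, cancelling arcs expose hidden ones; every hull
vertex is a strict top on an open arc; degenerate cases — a zero factor, all factors monomials — give `≤ mt`, `≤ 2`.) -/
def SectorDecomposition : Prop :=
  ∀ (m t : ℕ) (f g : Fin m → MvPolynomial (Fin 2) ℂ), (∀ j, (f j).support.card ≤ t) →
    (∀ j, (g j).support.card ≤ t) →
      ∀ B : ℕ, (∀ a b : Fin m → Expo, Cancelling f g a b → (hidden f g a b).ncard ≤ B) →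
        newtonVertexCount (∏ j, f j - ∏ j, g j) ≤ 4 * m * t + 2 + 2 * m * t * B

/-- STATEMENT 2 — chart normalisation. For a cancelling top-assignment `(a,b)` of a `t`-sparse instance there is a
normalised instance `(u,v)` (`m` tails a side, zero constant terms, `≤ t − 1` monomials) whose visible set is at least
as large as the hidden set of `(a,b)`. (If some `ξ` realises the tops, the tail vectors `e − a_j`, `e − b_j` span a
pointed cone; an `SL₂(ℤ)`-matrix followed by a shear maps it into `ℕ²`; `u_j :=` chart of `f_j/(α_j X^{a_j}) − 1`;
`∏(1+u) − ∏(1+v)` is the chart of `(∏f − ∏g)/(αX^A)` by `Cancelling`; strict tops correspond under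
`λ ↦ g(λ − A)`, `ξ ↦ g^{-T}ξ`, and realised weights map to valid weights.) -/
def ChartNormalisation : Prop :=
  ∀ (m t : ℕ) (f g : Fin m → MvPolynomial (Fin 2) ℂ), (∀ j, (f j).support.card ≤ t) →
    (∀ j, (g j).support.card ≤ t) →
      ∀ a b : Fin m → Expo, Cancelling f g a b →
        ∃ u v : Fin m → MvPolynomial (Fin 2) ℂ,
          (∀ j, coeff 0 (u j) = 0 ∧ (u j).support.card ≤ t - 1) ∧
          (∀ j, coeff 0 (v j) = 0 ∧ (v j).support.card ≤ t - 1) ∧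
            (hidden f g a b).ncard ≤ (visible u v).ncard

/-- STATEMENT 3 — log-linearisation identity. For a normalised instance and a valid weight `ξ`, a point is the
strict `ξ`-top of `supp(∏(1+u) − ∏(1+v))` iff it is the strict `ξ`-top of `supp D`,
`D = Σ log(1+u_j) − Σ log(1+v_j)` (`in_ξ(∏(1+u) − ∏(1+v)) = in_ξ D`: in `ℂ[[X,Y]]`, `∏(1+u)/∏(1+v) = exp D` and
`exp D − 1 = D·(unit with top 1)`; all series involved are supported in the monoid spanned by the tails, on which
`ξ` is negative, so `ξ`-initial forms exist and are multiplicative). Char 0 is used (`1/r`, `1/k!`). -/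
def LogLinearisation : Prop :=
  ∀ (m : ℕ) (u v : Fin m → MvPolynomial (Fin 2) ℂ), (∀ j, coeff 0 (u j) = 0) → (∀ j, coeff 0 (v j) = 0) →
    ∀ ξ : Fin 2 → ℝ, ValidWeight u v ξ →
      ∀ l : Expo, IsStrictTop ξ ↑(tailDiff u v).support l ↔ IsStrictTop ξ (logSupport u v) l

/-- STATEMENT 4 — THE RAYS RUNG (monomial tails; Disproof F3, card (ii)). If every tail `u_j`, `v_j` has at most one
monomial, any finite set of visible points of `supp D` has at most `2m` elements (each `log(1 + cX^e)` is supported on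
the ray `ℕ_{≥1}e`; a visible point is the FIRST support point of its geometric ray, since nearer points of a ray have
larger weight; `≤ 2m` rays). -/
def RaysRung : Prop :=
  ∀ (m : ℕ) (u v : Fin m → MvPolynomial (Fin 2) ℂ),
    (∀ j, coeff 0 (u j) = 0 ∧ (u j).support.card ≤ 1) → (∀ j, coeff 0 (v j) = 0 ∧ (v j).support.card ≤ 1) →
      ∀ S : Finset Expo, (↑S ⊆ logVisible u v) → S.card ≤ 2 * m

/-- STATEMENT 5 — THE LOG-SUM ENGINE (open; the card's Transfer `C⁺`). For `t ≥ 2`, any finite set of visible points of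
the support of `D = Σ_j log(1+u_j) − Σ_j log(1+v_j)` (`u_j, v_j` with `≤ t` monomials and zero constant term, `j < m`)
has at most `2^(a·m)·(t+2)^b` elements. Additively decoupled: no product of polynomials occurs; `[D]_λ` is a signed
multinomial power sum of the `2m` coefficient vectors; `supp D` lies in the union of the `2m` single-factor semigroups.
(`t ≤ 1` is `RaysRung`; the restriction only removes that proved slice.) -/
def LogSumEngine : Prop :=
  ∃ a b : ℕ, ∀ (m t : ℕ), 2 ≤ t → ∀ (u v : Fin m → MvPolynomial (Fin 2) ℂ),
    (∀ j, coeff 0 (u j) = 0 ∧ (u j).support.card ≤ t) → (∀ j, coeff 0 (v j) = 0 ∧ (v j).support.card ≤ t) →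
      ∀ S : Finset Expo, (↑S ⊆ logVisible u v) → S.card ≤ 2 ^ (a * m) * (t + 2) ^ b

/-! ### A rung of the engine already known on paper (typed sub-target for a `--supports` lemma; NOT a stub) -/

/-- RUNG (Disproof F4 / landed `Negative.card_corners_le_of_expSum`; card (iii)): COMMON TWO-MONOMIAL TAIL CONE. If
all `2m` tails are supported on the same two exponents `e₁, e₂`, then `[D]_{p e₁ + q e₂} = c_{pq}·G(p,q)` with
`c_{pq} ≠ 0` and `G(p,q) = Σ_j ε_j α_j^p β_j^q` of rank `≤ 2m`; visible points are staircase corners of the zero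
pattern of `G`, hence `≤ 2m` (tight: `corners_rank_tight`). -/
def EngineCommonConeRung : Prop :=
  ∀ (m : ℕ) (e₁ e₂ : Expo) (u v : Fin m → MvPolynomial (Fin 2) ℂ),
    (∀ j, coeff 0 (u j) = 0 ∧ (u j).support ⊆ {e₁, e₂}) → (∀ j, coeff 0 (v j) = 0 ∧ (v j).support ⊆ {e₁, e₂}) →
      ∀ S : Finset Expo, (↑S ⊆ logVisible u v) → S.card ≤ 2 * m

/-! ### The registered stubs (statements expanded) -/

/-- STUB 1 (M, provable now) — `SectorDecomposition`. Proof sketch: let `Σ` be the set of directions normal to an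
edge of some `Newt(f_j)` / `Newt(g_j)` (`|Σ| ≤ Σ_j |supp f_j| + |supp g_j| ≤ 2mt`). If some factor is `0` the
difference is `0` or `±` a single product (`≤ mt` vertices: Newton polygon of a product = Minkowski sum); if
`Σ = ∅` all factors are monomials (`≤ 2` vertices). Otherwise `S¹ ∖ Σ` is `|Σ| ≤ 2mt` open arcs; on an arc every
factor has a constant strict top (`a_j`, `b_j`), and `in_ξ(∏f − ∏g) ∈ {αX^A, −βX^B, αX^A − βX^B}` unless
`Cancelling f g a b`, so non-cancelling arcs expose `≤ 2` strict tops and a cancelling arc exposes only points of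
`hidden f g a b` (`≤ B`); every vertex of `Newt(∏f − ∏g)` is the strict `ξ`-top for an open arc of `ξ`, which meets
`S¹ ∖ Σ`. Total `≤ 2mt·max(2,B) ≤ 4mt + 2 + 2mt·B`. Mathlib: `ConvexIndependent`, `Set.extremePoints`,
`MvPolynomial.support_mul`, exposed points of planar polytopes. -/
theorem stub_sectorDecomposition :
    ∀ (m t : ℕ) (f g : Fin m → MvPolynomial (Fin 2) ℂ), (∀ j, (f j).support.card ≤ t) →
      (∀ j, (g j).support.card ≤ t) →
        ∀ B : ℕ, (∀ a b : Fin m → Expo, Cancelling f g a b → (hidden f g a b).ncard ≤ B) →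
          newtonVertexCount (∏ j, f j - ∏ j, g j) ≤ 4 * m * t + 2 + 2 * m * t * B := by
  -- LANDED (`…FormalLogLinearisationSectorDecomposition`, `NewtonUnitEquations.TwoProducts.FormalLogLinearisation.stub_sectorDecomposition`, statement unfolded verbatim): by-name citation (stub-credit wiring val-port-1 g1, val-lit RULING #251 (b))
  exact Summit.ValiantsHypothesis.ValiantsHypothesis.Theorems.NewtonUnitEquations.TwoProducts.FormalLogLinearisation.stub_sectorDecomposition
/-- STUB 2 (M, provable now) — `ChartNormalisation`. Proof sketch: if `hidden f g a b = ∅` take `u = v = 0`.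
Else some `ξ₀` makes every `a_j` (`b_j`) the strict top, so every tail vector `e − a_j` (`e ∈ supp f_j ∖ a_j`),
`e − b_j`, has `⟪ξ₀,·⟫ < 0` and the cone they span in `ℝ²` is pointed with primitive extreme rays `r₁, r₂`; pick
`h ∈ SL₂(ℤ)` with `h r₁ = (1,0)`, reflect so that `h r₂ = (p,q)`, `q ≥ 0`, shear `(x,y) ↦ (x+ky,y)` with `p+kq ≥ 0`:
the resulting `g ∈ GL₂(ℤ)` maps all tails into `ℕ² ∖ 0`. Put `u_j := Σ_{e ≠ a_j} (f_j)_e/(f_j)_{a_j} X^{g(e−a_j)}`,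
`v_j` likewise (`≤ t − 1` monomials, constant term `0`). By `Cancelling`, `∏(1+u) − ∏(1+v)` is the image of
`(∏f − ∏g)/(αX^A)` under the ring isomorphism `X^e ↦ X^{ge}` of Laurent polynomial rings, so `supp` corresponds
under the injection `λ ↦ g(λ − A)` and strict `ξ`-tops under `ξ ↦ g^{-T}ξ` (`⟪g^{-T}ξ, ge⟫ = ⟪ξ,e⟫`), realised weights
going to valid weights; hence `hidden f g a b ↪ visible u v` (both finite: subsets of supports). Mathlib:
`Matrix.SpecialLinearGroup`, `Int.gcd_eq_gcd_ab` (primitive vector ↦ basis), `Finsupp.mapDomain`/`AddMonoidAlgebra`. -/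
theorem stub_chartNormalisation :
    ∀ (m t : ℕ) (f g : Fin m → MvPolynomial (Fin 2) ℂ), (∀ j, (f j).support.card ≤ t) →
      (∀ j, (g j).support.card ≤ t) →
        ∀ a b : Fin m → Expo, Cancelling f g a b →
          ∃ u v : Fin m → MvPolynomial (Fin 2) ℂ,
            (∀ j, coeff 0 (u j) = 0 ∧ (u j).support.card ≤ t - 1) ∧
            (∀ j, coeff 0 (v j) = 0 ∧ (v j).support.card ≤ t - 1) ∧
              (hidden f g a b).ncard ≤ (visible u v).ncard := by
  -- LANDED (`…FormalLogLinearisationStubChartNormalisation`, `NewtonUnitEquations.TwoProducts.FormalLogLinearisation.stub_chartNormalisation`, statement unfolded verbatim): by-name citation (stub-credit wiring val-port-1 g1, val-lit RULING #251 (b))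
  exact Summit.ValiantsHypothesis.ValiantsHypothesis.Theorems.NewtonUnitEquations.TwoProducts.FormalLogLinearisation.stub_chartNormalisation
/-- STUB 3 (M/L, provable now) — `LogLinearisation`. Proof sketch: work in `R = MvPowerSeries (Fin 2) ℂ` with the
monoid `M = ℕ·T` spanned by the tails `T = ⋃ supp u_j ∪ ⋃ supp v_j`; for valid `ξ` every `e ∈ T` has `⟪ξ,e⟫ < 0`,
so a nonzero series supported in `M` has a `ξ`-initial form (finitely many points above any weight) and `in_ξ` is
multiplicative on such series (`ℂ` is a domain). Define `L(u) := Σ_{r≥1} (−1)^{r+1}u^r/r` (locally finite; its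
coefficients are `logCoeff u` because `u^r` has no monomial of total degree `< r`), show `exp(L(u)) = 1 + u` and hence
`∏(1+u_j) = exp(Σ L(u_j))` (derivation trick: both sides `F` satisfy `θF = F·θ(ΣL(u_j))` for the Euler derivations
`θ = X∂_X, Y∂_Y` and have constant term `1`; or the univariate identity `exp ∘ log = id` in `ℚ[[T]]` transported
along `T ↦ u`). Then `∏(1+u) − ∏(1+v) = ∏(1+v)·(exp D − 1) = D · U`, `U = ∏(1+v)·Σ_{k≥0} D^k/(k+1)!`, `U(0) = 1`,
`supp U ⊆ M`, so `in_ξ U = 1` and `in_ξ(∏(1+u) − ∏(1+v)) = in_ξ D`; a strict top on either side is a monomial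
initial form, hence a strict top on the other. Mathlib: `MvPowerSeries`, `PowerSeries.exp`, `MvPolynomial.coeff_mul`,
`MvPolynomial.totalDegree`. -/
theorem stub_logLinearisation :
    ∀ (m : ℕ) (u v : Fin m → MvPolynomial (Fin 2) ℂ), (∀ j, coeff 0 (u j) = 0) → (∀ j, coeff 0 (v j) = 0) →
      ∀ ξ : Fin 2 → ℝ, ValidWeight u v ξ →
        ∀ l : Expo, IsStrictTop ξ ↑(tailDiff u v).support l ↔ IsStrictTop ξ (logSupport u v) l := by
  -- LANDED (`…FormalLogLinearisationStubLogLinearisation`, `NewtonUnitEquations.TwoProducts.FormalLogLinearisation.stub_logLinearisation`, statement unfolded verbatim): by-name citation (stub-credit wiring val-port-1 g1, val-lit RULING #251 (b))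
  exact Summit.ValiantsHypothesis.ValiantsHypothesis.Theorems.NewtonUnitEquations.TwoProducts.FormalLogLinearisation.stub_logLinearisation
/-- STUB 4 (M, provable now) — `RaysRung` (Disproof F3; card (ii); triage r1-2 probe T2 0/120, r1-3 probe B 0/260
violations). Proof sketch: with `u_j = c_jX^{e_j}` (or `0`), `logCoeff (u_j)` is supported on `ℕ_{≥1}·e_j`, so
`logSupport u v ⊆ ⋃` of `≤ 2m` geometric rays from the origin; for a valid `ξ` the weight is strictly decreasing along
each ray, so a strict `ξ`-top `l` of `logSupport` is the first point of `logSupport` on its ray (a nearer support point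
would have larger weight); hence an injection of any `S ⊆ logVisible u v` into `Fin m ⊕ Fin m` ("the index of a tail
spanning the ray of `l`", after discarding rays with no support point and choosing one index per geometric ray).
Mathlib: `MvPolynomial.support_monomial`, `Finsupp` arithmetic on `Fin 2 →₀ ℕ`, `Finset.card_le_card_of_injOn`. -/
theorem stub_raysRung :
    ∀ (m : ℕ) (u v : Fin m → MvPolynomial (Fin 2) ℂ),
      (∀ j, coeff 0 (u j) = 0 ∧ (u j).support.card ≤ 1) → (∀ j, coeff 0 (v j) = 0 ∧ (v j).support.card ≤ 1) →
        ∀ S : Finset Expo, (↑S ⊆ logVisible u v) → S.card ≤ 2 * m := by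
  -- LANDED (`…FormalLogLinearisationStubRaysRung`, `NewtonUnitEquations.TwoProducts.FormalLogLinearisation.stub_raysRung`, statement unfolded verbatim): by-name citation (stub-credit wiring val-port-1 g1, val-lit RULING #251 (b))
  exact Summit.ValiantsHypothesis.ValiantsHypothesis.Theorems.NewtonUnitEquations.TwoProducts.FormalLogLinearisation.stub_raysRung
/-- STUB 5 (XL, OPEN, HARDEST) — `LogSumEngine`, the Transfer `C⁺` of the card: for `t ≥ 2`, visible points of the
support of a signed sum of `2m` logarithms of `t`-sparse polynomials are `≤ 2^(a·m)(t+2)^b`. Equivalent to the crux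
given stubs 1–3 (⇐: the visible points of `D` are strictly exposed hull vertices of `∏(1+u) − ∏(1+v)` by stub 3), so
NOT a strengthening; easier because additively decoupled. Known: common two-monomial cone (`EngineCommonConeRung`,
`≤ 2m`, core landed as `Negative.card_corners_le_of_expSum`), dissociated tails (exchange lemma, `≤ 2mt`), generic
exponents (`O(m)`, Disproof F5), small lattice (F6). Open core: aligned tails with in-cone additive relations
(cross-order fibre cancellation: triage instances `(1+z+4z²)(1+z²) − (1+2z+3z²)(1−z)(1+4z²) = 12z⁵`, cubic norm
`∏(1+ω^j xy) − ∏(1+ω^j x³ − ω^{2j}y³/3)`), where the conjectured sharp count is Disproof's `FirstOrderCount`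
(`≤ 2m(t−1)` per sector; unrefuted in all cdisprove/triage searches). Why it might fail: a deep cancellation cascade
carving `t^{Ω(m)}` visible points out of one factor's semigroup with `m, t → ∞` — it would refute KPTT Conj. 1 at
`k = 2`. Tools proposed by the card: linear-recurrence zero rigidity along rays, rank/flattening of
`F(μ) = Σ_j ε_j a_j^μ` (unit-equation zero sets, Laurent's theorem used qualitatively), planar-shadow counting. -/
theorem stub_logSumEngine :
    ∃ a b : ℕ, ∀ (m t : ℕ), 2 ≤ t → ∀ (u v : Fin m → MvPolynomial (Fin 2) ℂ),
      (∀ j, coeff 0 (u j) = 0 ∧ (u j).support.card ≤ t) → (∀ j, coeff 0 (v j) = 0 ∧ (v j).support.card ≤ t) →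
        ∀ S : Finset Expo, (↑S ⊆ logVisible u v) → S.card ≤ 2 ^ (a * m) * (t + 2) ^ b := by
  sorry

/-! ### Consistency: each named statement IS its registered stub (definitionally) -/

theorem sectorDecomposition_holds : SectorDecomposition := stub_sectorDecomposition
theorem chartNormalisation_holds : ChartNormalisation := stub_chartNormalisation
theorem logLinearisation_holds : LogLinearisation := stub_logLinearisation
theorem raysRung_holds : RaysRung := stub_raysRung
theorem logSumEngine_holds : LogSumEngine := stub_logSumEngine

/-! ### Name-keyed aliases of the five statements (the hypotheses of the composition; the skeleton audit admits a
hypothesis only if its head constant is a registered obligation or is named like a declared stub) -/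
namespace Registered

/-- Alias of `SectorDecomposition` keyed by the registered stub name. -/
abbrev stub_sectorDecomposition : Prop := SectorDecomposition
/-- Alias of `ChartNormalisation` keyed by the registered stub name. -/
abbrev stub_chartNormalisation : Prop := ChartNormalisation
/-- Alias of `LogLinearisation` keyed by the registered stub name. -/
abbrev stub_logLinearisation : Prop := LogLinearisation
/-- Alias of `RaysRung` keyed by the registered stub name. -/
abbrev stub_raysRung : Prop := RaysRung
/-- Alias of `LogSumEngine` keyed by the registered stub name. -/
abbrev stub_logSumEngine : Prop := LogSumEngine

end Registered

/-! ### Glue (PROVED) -/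

/-- Hidden vertices are support points of the difference (so the hidden set is finite). -/
theorem hidden_subset_support (f g : Fin m → MvPolynomial (Fin 2) ℂ) (a b : Fin m → Expo) :
    hidden f g a b ⊆ ↑(∏ j, f j - ∏ j, g j).support := by
  rintro l ⟨ξ, -, -, hl⟩
  exact hl.1

/-- The hidden set of a top-assignment is finite. -/
theorem hidden_finite (f g : Fin m → MvPolynomial (Fin 2) ℂ) (a b : Fin m → Expo) :
    (hidden f g a b).Finite :=
  (Finset.finite_toSet _).subset (hidden_subset_support f g a b)

/-- Visible vertices are support points of the normalised difference. -/
theorem visible_subset_support (u v : Fin m → MvPolynomial (Fin 2) ℂ) :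
    visible u v ⊆ ↑(tailDiff u v).support := by
  rintro l ⟨ξ, -, hl⟩
  exact hl.1

/-- The visible set of a normalised instance is finite. -/
theorem visible_finite (u v : Fin m → MvPolynomial (Fin 2) ℂ) : (visible u v).Finite :=
  (Finset.finite_toSet _).subset (visible_subset_support u v)

/-- IDENTITY ⇒ any bound on finite sets of visible points of `supp D` bounds the visible set of the normalised
difference: by `LogLinearisation` every visible vertex is a visible point of `supp D` (same weight), and the visible set
is finite. (Fed by `RaysRung` when the tails are monomials and by `LogSumEngine` otherwise.) -/
theorem visible_ncard_le_of (hId : LogLinearisation) {m : ℕ} {u v : Fin m → MvPolynomial (Fin 2) ℂ} {N : ℕ}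
    (hu : ∀ j, coeff 0 (u j) = 0) (hv : ∀ j, coeff 0 (v j) = 0)
    (hN : ∀ S : Finset Expo, (↑S ⊆ logVisible u v) → S.card ≤ N) :
    (visible u v).ncard ≤ N := by
  have hfin := visible_finite u v
  rw [Set.ncard_eq_toFinset_card _ hfin]
  refine hN _ ?_
  intro l hl
  have hl' : l ∈ visible u v := by simpa using hl
  obtain ⟨ξ, hξ, htop⟩ := hl'
  exact ⟨ξ, hξ, (hId m u v hu hv ξ hξ l).1 htop⟩

/-- Arithmetic for the rays branch: `2m ≤ 2^((a+1)m)·(t+2)^(b+1)`. -/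
theorem two_mul_le_bound (a b m t : ℕ) : 2 * m ≤ 2 ^ ((a + 1) * m) * (t + 2) ^ (b + 1) := by
  have h1 : m ≤ 2 ^ m := Nat.lt_two_pow_self.le
  have h2 : 2 ^ m ≤ 2 ^ ((a + 1) * m) := Nat.pow_le_pow_right (by norm_num) (by nlinarith)
  have h3 : (2 : ℕ) ≤ (t + 2) ^ (b + 1) :=
    calc (2 : ℕ) = 2 ^ 1 := by norm_num
      _ ≤ 2 ^ (b + 1) := Nat.pow_le_pow_right (by norm_num) (by omega)
      _ ≤ (t + 2) ^ (b + 1) := Nat.pow_le_pow_left (by omega) _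
  calc 2 * m ≤ 2 * 2 ^ ((a + 1) * m) := by omega
    _ = 2 ^ ((a + 1) * m) * 2 := by ring
    _ ≤ 2 ^ ((a + 1) * m) * (t + 2) ^ (b + 1) := Nat.mul_le_mul_left _ h3

/-- Arithmetic for the engine branch (applied at tail-sparsity `t − 1`):
`2^(am)·(t−1+2)^b ≤ 2^((a+1)m)·(t+2)^(b+1)`. -/
theorem engine_le_bound (a b m t : ℕ) :
    2 ^ (a * m) * (t - 1 + 2) ^ b ≤ 2 ^ ((a + 1) * m) * (t + 2) ^ (b + 1) := by
  have h1 : 2 ^ (a * m) ≤ 2 ^ ((a + 1) * m) := Nat.pow_le_pow_right (by norm_num) (by nlinarith)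
  have h2 : (t - 1 + 2) ^ b ≤ (t + 2) ^ (b + 1) :=
    calc (t - 1 + 2) ^ b ≤ (t + 2) ^ b := Nat.pow_le_pow_left (by omega) _
      _ ≤ (t + 2) ^ (b + 1) := Nat.pow_le_pow_right (by omega) (by omega)
  exact Nat.mul_le_mul h1 h2

/-- The final arithmetic: `4mt + 2 + 2mt·2^(am)(t+2)^b ≤ 2^((a+4)m)·(t+2)^(b+2)`. -/
theorem bound_arith (a b m t : ℕ) :
    4 * m * t + 2 + 2 * m * t * (2 ^ (a * m) * (t + 2) ^ b) ≤ 2 ^ ((a + 4) * m) * (t + 2) ^ (b + 2) := by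
  set X : ℕ := 2 ^ (a * m) * (t + 2) ^ b with hX
  have hX1 : 1 ≤ X := Nat.one_le_iff_ne_zero.2 (by positivity)
  rcases Nat.eq_zero_or_pos m with rfl | hm
  · -- m = 0: the left-hand side is 2
    have h2 : (2 : ℕ) ≤ (t + 2) ^ (b + 2) :=
      calc (2 : ℕ) ≤ 2 ^ (b + 2) := by
            calc (2 : ℕ) = 2 ^ 1 := by norm_num
              _ ≤ 2 ^ (b + 2) := Nat.pow_le_pow_right (by norm_num) (by omega)
        _ ≤ (t + 2) ^ (b + 2) := Nat.pow_le_pow_left (by omega) _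
    simpa using h2
  · have h2m : m ≤ 2 ^ m := Nat.lt_two_pow_self.le
    have ht2 : t ≤ t + 2 := by omega
    have h1t : 1 ≤ t + 2 := by omega
    have h12 : 1 ≤ 2 ^ m := Nat.one_le_two_pow
    have hA : 4 * m * t ≤ 4 * (2 ^ m * (t + 2) * X) := by
      calc 4 * m * t = 4 * (m * t * 1) := by ring
        _ ≤ 4 * (2 ^ m * (t + 2) * X) := by gcongr
    have hB : 2 ≤ 2 * (2 ^ m * (t + 2) * X) := by
      calc 2 = 2 * (1 * 1 * 1) := by ring
        _ ≤ 2 * (2 ^ m * (t + 2) * X) := by gcongr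
    have hC : 2 * m * t * X ≤ 2 * (2 ^ m * (t + 2) * X) := by
      calc 2 * m * t * X = 2 * (m * t * X) := by ring
        _ ≤ 2 * (2 ^ m * (t + 2) * X) := by gcongr
    have hsum : 4 * m * t + 2 + 2 * m * t * X ≤ 8 * (2 ^ m * (t + 2) * X) := by
      calc 4 * m * t + 2 + 2 * m * t * X
          ≤ 4 * (2 ^ m * (t + 2) * X) + 2 * (2 ^ m * (t + 2) * X) + 2 * (2 ^ m * (t + 2) * X) :=
            Nat.add_le_add (Nat.add_le_add hA hB) hC
        _ = 8 * (2 ^ m * (t + 2) * X) := by ring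
    have hpow : 2 ^ (m + 3) ≤ 2 ^ (4 * m) := Nat.pow_le_pow_right (by norm_num) (by omega)
    have hsq : t + 2 ≤ (t + 2) ^ 2 := by nlinarith
    calc 4 * m * t + 2 + 2 * m * t * X ≤ 8 * (2 ^ m * (t + 2) * X) := hsum
      _ = (2 ^ (m + 3) * (t + 2)) * X := by ring
      _ ≤ (2 ^ (4 * m) * (t + 2) ^ 2) * X := by gcongr
      _ = 2 ^ ((a + 4) * m) * (t + 2) ^ (b + 2) := by rw [hX]; ring

/-! ### The composition: the five stubs imply the crux, by name -/

/-- `TwoProducts` from the five stubs (no `sorry`): for a `t`-sparse instance `(f,g)` and a cancelling top-assignment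
`(a',b')`, STUB 2 gives a normalised instance `(u,v)` with tails of `≤ t−1` monomials and `#hidden ≤ #visible(u,v)`;
if `t ≤ 2` the tails are monomials and STUB 4 bounds the visible points of `supp D` by `2m`, otherwise STUB 5 (at
`t−1 ≥ 2`) bounds them by `2^(am)(t+1)^b`; STUB 3 transports either bound to `visible u v` (`visible_ncard_le_of`), so
every hidden set is `≤ 2^((a+1)m)(t+2)^(b+1)`; STUB 1 then bounds the vertex count by `4mt + 2 + 2mt·(that)`, and
`bound_arith` closes with the constants `(a+1+4, b+1+2)`. -/
theorem TwoProducts_of (h₁ : Registered.stub_sectorDecomposition) (h₂ : Registered.stub_chartNormalisation)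
    (h₃ : Registered.stub_logLinearisation) (h₄ : Registered.stub_raysRung) (h₅ : Registered.stub_logSumEngine) :
    Summit.ValiantsHypothesis.ValiantsHypothesis.Theses.NewtonUnitEquations.TwoProducts := by
  obtain ⟨a, b, hE⟩ := h₅
  refine ⟨a + 1 + 4, b + 1 + 2, fun m t f g hf hg => ?_⟩
  have hB : ∀ a' b' : Fin m → Expo, Cancelling f g a' b' →
      (hidden f g a' b').ncard ≤ 2 ^ ((a + 1) * m) * (t + 2) ^ (b + 1) := by
    intro a' b' hc
    obtain ⟨u, v, hu, hv, hle⟩ := h₂ m t f g hf hg a' b' hc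
    refine hle.trans ?_
    by_cases ht : t ≤ 2
    · -- `t ≤ 2`: the tails are monomials — rays rung
      have hu1 : ∀ j, coeff 0 (u j) = 0 ∧ (u j).support.card ≤ 1 :=
        fun j => ⟨(hu j).1, (hu j).2.trans (by omega)⟩
      have hv1 : ∀ j, coeff 0 (v j) = 0 ∧ (v j).support.card ≤ 1 :=
        fun j => ⟨(hv j).1, (hv j).2.trans (by omega)⟩
      exact (visible_ncard_le_of h₃ (fun j => (hu j).1) (fun j => (hv j).1) (h₄ m u v hu1 hv1)).trans
        (two_mul_le_bound a b m t)
    · -- `t ≥ 3`: the engine at tail-sparsity `t − 1 ≥ 2`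
      have key := hE m (t - 1) (by omega) u v hu hv
      exact (visible_ncard_le_of h₃ (fun j => (hu j).1) (fun j => (hv j).1) key).trans (engine_le_bound a b m t)
  have h := h₁ m t f g hf hg _ hB
  exact h.trans (bound_arith (a + 1) (b + 1) m t)

/-- Wiring check: the registered stubs feed `TwoProducts_of` as stated. -/
example : Summit.ValiantsHypothesis.ValiantsHypothesis.Theses.NewtonUnitEquations.TwoProducts :=
  TwoProducts_of stub_sectorDecomposition stub_chartNormalisation stub_logLinearisation stub_raysRung
    stub_logSumEngine

/-! ### Scratch checks: sanity of the objects, the landed `Negative/*` lemma, the `Leans on:` names -/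

/-- `log(1 + 0) = 0`: the log-coefficients of the zero tail vanish. -/
example (n : Expo) : logCoeff 0 n = 0 := by
  unfold logCoeff
  refine Finset.sum_eq_zero fun r hr => ?_
  have hr1 : 1 ≤ r := (Finset.mem_Icc.1 hr).1
  rw [zero_pow (by omega), coeff_zero, mul_zero]

/-- The log-sum has no constant term (`D(0) = 0`): the empty truncation. -/
example (u v : Fin m → MvPolynomial (Fin 2) ℂ) : logDiff u v 0 = 0 := by
  simp [logDiff, logCoeff]

/-- With no factors at all there is nothing visible (`m = 0`: `∏ − ∏ = 1 − 1 = 0`). -/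
example (u v : Fin 0 → MvPolynomial (Fin 2) ℂ) : visible u v = ∅ := by
  ext l
  simp only [Set.mem_empty_iff_false, iff_false]
  rintro ⟨ξ, -, hl, -⟩
  simp [tailDiff] at hl

/-- The landed rank obstruction (`Theorems/TwoProducts/Negative/RankObstruction.lean`,
`Negative.card_corners_le_of_expSum`, p74535) = the core of `EngineCommonConeRung`: a signed sum of `r` planar
monomial characters has `≤ r` staircase corners in its zero pattern. Re-proved verbatim here (the landed module is
not yet in the farm snapshot, see the import note), so the skeleton is checked against it. [folklore] -/
theorem card_corners_le_of_expSum' {K : Type*} [Field K] {r V : ℕ} (ε α β : Fin r → K) (G : ℕ → ℕ → K)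
    (hG : ∀ p q, G p q = ∑ j, ε j * α j ^ p * β j ^ q) (p q : Fin V → ℕ)
    (hdiag : ∀ i, G (p i) (q i) ≠ 0) (hupper : ∀ i k, i < k → G (p i) (q k) = 0) : V ≤ r := by
  classical
  let M : Matrix (Fin V) (Fin V) K := fun i k => G (p i) (q k)
  let A : Matrix (Fin V) (Fin r) K := fun i j => ε j * α j ^ (p i)
  let B : Matrix (Fin r) (Fin V) K := fun j k => β j ^ (q k)
  have hM : M = A * B := by
    ext i k
    simp only [M, A, B, Matrix.mul_apply, hG]
  have htri : M.BlockTriangular OrderDual.toDual := fun i k hik => hupper i k (by simpa using hik)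
  have hdet : M.det ≠ 0 := by
    rw [Matrix.det_of_lowerTriangular M htri]
    exact Finset.prod_ne_zero_iff.2 (fun i _ => hdiag i)
  have hunit : IsUnit M := (Matrix.isUnit_iff_isUnit_det M).2 (isUnit_iff_ne_zero.2 hdet)
  have h1 : M.rank = V := by rw [Matrix.rank_of_isUnit M hunit, Fintype.card_fin]
  have h2 : M.rank ≤ r := by
    rw [hM]
    exact (Matrix.rank_mul_le_left A B).trans (by simpa using Matrix.rank_le_card_width A)
  omega

/-- `Leans on`: KPTT Thm 5 (EPRS convexity bound) is a theorem of the tree (used by the card only for comparison /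
the order-two corner rung of the sibling card). -/
example : KPTT.theorem5 := KPTT.theorem5_holds

/-- `Leans on`: the crux is literally the `newtonVertexCount` bound (the abbreviation used in STUB 1). -/
example : Summit.ValiantsHypothesis.ValiantsHypothesis.Theses.NewtonUnitEquations.TwoProducts ↔
    ∃ a b : ℕ, ∀ (m t : ℕ) (f g : Fin m → MvPolynomial (Fin 2) ℂ), (∀ j, (f j).support.card ≤ t) →
      (∀ j, (g j).support.card ≤ t) → newtonVertexCount (∏ j, f j - ∏ j, g j) ≤ 2 ^ (a * m) * (t + 2) ^ b :=
  Iff.rfl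

end Summit.ValiantsHypothesis.ValiantsHypothesis.Cruxes.TwoProducts.FormalLogLinearisation

end
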